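import Summits.AtomisticToContinuum.Crystallization.Theorems.ChartedZeroExcessLayeredLatticeLiouvilleZZZB
import Summits.AtomisticToContinuum.Crystallization.Theorems.ChartedZeroExcessLayeredLatticeLiouvilleZZU

/-!
# Charted zero-excess layered lattices — Part ZZZC: the (B′.5) SKELETON, REGISTRATION-TRANSPORT EDITION «slabIso_package_reg»

Route `ChartedPlanarOrder`, station L2′, lineage `stmt-AtomisticToContinuum-26636`; critic rows 1487 (A) / 1488 / 1490
(SKELETON-FIRST), ★ row 1508 (FINDING «IC» UPHELD; F3 `_reg` editions «GO TO STAGE THIS GENERATION»; «NO further 26636-lane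
landing consumes `slabIso_package` (ZZU) from now on — consumers wait for `slabIso_package_reg`»).  Imports Part ZZZB
(`pin_extension_reg_record`) and tree Part ZZU (windows, the three metric riders, `exists_partnerMap`; ZZU's own
`slabIso_package` is NOT used).

WHY A NEW EDITION (FINDING «IC», memo FINDING-IC.md, critic row 1508 (A)).  The landed skeleton `slabIso_package` (Part ZZU)
consumes the C-side DIAL BLOCK `hϑ haLo hbond hlo hhi` + `hgoodC` (two-shell goodness of the target crystal `C` at dials
`(ϑ, aLo, aHi)` with `aHi·(1 + 2ϑ) ≤ 28/25` and `√2 + 1/16 + 2ε ≤ 3/2·aLo`).  That block is UNSATISFIABLE on admissible (GL)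
instances (`S = H = C = a⋆·fcc`, `a⋆ ∈ [9/10, 0.9367)`: the second shell `a⋆√2` misses every admissible pattern shell), so it
cannot be discharged from the route's binders.  This edition replaces it by NOTHING: the pin extension runs on the
REGISTRATION-TRANSPORT step `pin_step_reg` (Part ZZZA: the partner pattern `BarlowFour` is transported through the registered
link sites by the KERNEL FACT that `≥ 5` common neighbours characterise adjacency inside the two-shell ball of a Barlow
graph, and non-adjacency by S-cleanliness + the lower window `28/25 + 2ε < 9/10·(√2 − 1/16)`, which holds for `ε ≤ 1/40`).

★★★ `slabIso_package_reg`.  INPUT: as `slabIso_package` MINUS `{ϑ aLo aHi} hϑ haLo hbond hlo hlo' hhi hgoodC` (the lower-window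
dial `hlo'` is DERIVED from `hε : ε ≤ 1/40` and `sqrt_two_bounds`).  OUTPUT: the six `X_Θ` clauses of `slabIso_package` with ONE
change of substance — clause 5 (partners `Θ y ∈ D″`, `dist (Ψ y) (Φ″ (Θ y)) ≤ ε`) is delivered on the PIN MOAT
`moatIn S K (145/16) (43/2)` within `13` of `K` instead of the whole moat `moatIn S K 8 (43/2)`: the transport processes a site
only where ALL TWELVE of its link sites are registered, i.e. from `d(Ψ x, K) > 8 + βS`, `βS ≤ 17/16` (Part ZZZB
`pin_extension_reg_record`) — and one bookkeeping widening: clause 6 (`x.1 ∈ Kread`) is stated for all sites within `179/16` of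
`K` (what rider R2-S gives at `j = 0`; ZZU stated it within `8`), so that the junction Part ZZP can be instantiated at ANY label
radius `r_Θ ≤ 179/16` (it reads clause 6 at `r = r_Θ`).  The
INNER COLLAR `d ∈ (8, 145/16]` is the booked obstruction «IC» of the (B′.5) junction (critic row 1508 (b): way out W1 =
statement-level r-gap `r_Θ ≥ 145/16`, or W3 = an inner-collar pin); this file is neutral between them — under W1 it is
consumed as is (any `r_Θ ≥ 145/16`), under W3 the inner-collar lemma extends clause 5 down to `8`.

PROOF = the proof of `slabIso_package` VERBATIM (partner map ⇒ link maps (Part ZZ) ⇒ normalised chart (Part ZZS, R1) ⇒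
slab isomorphism (Part ZZR, R1) ⇒ readability (R2-C) ⇒ registration `hA″` on the whole moat up to `1067/80` ⇒ container
`N = {y | y.1 ∈ Kread}` three links deep (R2-S)) with the `hgoodC`-fed goodness block DELETED and Part ZZT
`pin_extension_record` replaced by Part ZZZB `pin_extension_reg_record` (known band `(179/16, 1067/80] ⊂ W′` unchanged).
★ `slabIso_package_reg_of_empty`: the degenerate container `K = ∅`.

Must-fail companion (HOME dev/MustFailRF.lean, CHECKS-RF.md): (MFr3) `hout` on the moat `(9, 43/2)` instead of `(8, 43/2)`
does not feed this theorem; CONTROL: `slabIso_package_reg` fed by `windowConnected` (Part ZZZ) / `layerCovered` (Part ZZV) /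
`readCovered` (Part ZZW) elaborates.
-/

noncomputable section
open scoped RealInnerProductSpace
open Literature.Geometry.DiscreteGeometry (IsTwoShellGoodSet)

namespace Summit.AtomisticToContinuum.Crystallization.Theorems.ChartedZeroExcessLayeredLatticeLiouville

open Summit.AtomisticToContinuum.Crystallization.Theorems.ChartedPlanarOrderRigidityDoor (E3)

/-- ★★★ **THE (B′.5) SKELETON, REGISTRATION-TRANSPORT EDITION.**  See the module docstring: from the windows, the
REDUCED target interface (chart `Φ, τC, D` of `C`, separation, bond gap, link closure within `21/2`, partners on the
moat — NO two-shell goodness of `C`, NO pin-step dials) and the three metric riders to the `X_Θ` binders with the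
pinning clause on the PIN MOAT `moatIn S K (145/16) (43/2)` (inner collar `(8, 145/16]` = obstruction «IC»). -/
theorem slabIso_package_reg {S C K : Set E3} {D : Set (ℤ × ℤ × ℤ)} {Ψ Φ : ℤ × ℤ × ℤ → E3} {τS τC : ℤ → Bool}
    {ε δS βS δC βC : ℝ} {x₀ : E3}
    (hΨ : IsBarlowBondChart S Set.univ Ψ τS) (hsurjΨ : ∀ p ∈ S, ∃ x, Ψ x = p)
    (hclean : ∀ p ∈ S, IsTwoShellGoodSet (1 / 16) (9 / 10) 1 S p)
    (hsepS : ∀ p ∈ S, ∀ p' ∈ S, p ≠ p' → δS ≤ dist p p') (hεS : 2 * ε < δS)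
    (hgapS : ∀ p ∈ S, ∀ p' ∈ S, IsBond p p' → dist p p' ≤ βS) (hβS : βS + 2 * ε ≤ 28 / 25)
    (hβS' : βS ≤ 17 / 16)
    (hΦ : IsBarlowBondChart C D Φ τC)
    (hsepC : ∀ c ∈ C, ∀ c' ∈ C, c ≠ c' → δC ≤ dist c c') (hεC : 2 * ε < δC)
    (hgapC : ∀ c ∈ C, ∀ c' ∈ C, IsBond c c' → dist c c' ≤ βC) (hβC : βC + 2 * ε ≤ 28 / 25)
    (hε : ε ≤ 1 / 40)
    (hlc : ∀ y ∈ D, (∃ k ∈ K, dist (Φ y) k < 21 / 2) → ∀ y' : ℤ × ℤ × ℤ, BarlowAdj τC y y' → y' ∈ D)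
    (hKS : K ⊆ S) (hKfin : K.Finite) (hKne : K.Nonempty) (hK : ∀ k ∈ K, dist k x₀ ≤ 4)
    (hout : ∀ p ∈ moatIn S K 8 (43 / 2), ∃ y ∈ D, dist p (Φ y) ≤ ε)
    (hfin : Set.Finite {x : ℤ × ℤ × ℤ | ∃ k ∈ K, dist (Ψ x) k ≤ 43 / 2})
    (hR1 : WindowConnected S K Ψ τS) (hR2S : LayerCovered S K Ψ) (hR2C : ReadCovered S K D Ψ Φ ε) :
    ∃ (Θ : ℤ × ℤ × ℤ → ℤ × ℤ × ℤ) (Kread : Set ℤ) (Φ'' : ℤ × ℤ × ℤ → E3) (τ'' : ℤ → Bool)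
      (D'' : Set (ℤ × ℤ × ℤ)),
      IsBarlowBondChart C D'' Φ'' τ'' ∧
      (∀ y ∈ D'', (∃ k ∈ K, dist (Φ'' y) k < 21 / 2) → ∀ y' : ℤ × ℤ × ℤ, BarlowAdj τ'' y y' → y' ∈ D'') ∧
      Function.Injective Θ ∧
      (∀ x x' : ℤ × ℤ × ℤ, x.1 ∈ Kread → (BarlowAdj τS x x' ↔ BarlowAdj τ'' (Θ x) (Θ x'))) ∧
      (∀ y : ℤ × ℤ × ℤ, Ψ y ∈ moatIn S K (145 / 16) (43 / 2) → (∃ k ∈ K, dist (Ψ y) k < 13) →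
        Θ y ∈ D'' ∧ dist (Ψ y) (Φ'' (Θ y)) ≤ ε) ∧
      (∀ x : ℤ × ℤ × ℤ, (∃ k ∈ K, dist (Ψ x) k ≤ 179 / 16) → x.1 ∈ Kread) := by
  classical
  -- ### the one numeric dial of the transport: the lower shell-2 window (`ε ≤ 1/40`, `√2 > 1.41421356`)
  have hlo' : 28 / 25 + 2 * ε < 9 / 10 * (Real.sqrt 2 - 1 / 16) := by
    have h2 := sqrt_two_bounds
    linarith [h2.1]
  -- ### partners on the whole moat `A = window 8 (43/2)`
  obtain ⟨g, hA⟩ := exists_partnerMap hout Ψ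
  have puniq : ∀ (z y₁ y₂ : ℤ × ℤ × ℤ), y₁ ∈ D → y₂ ∈ D → dist (Ψ z) (Φ y₁) ≤ ε →
      dist (Ψ z) (Φ y₂) ≤ ε → y₁ = y₂ := by
    intro z y₁ y₂ h₁ h₂ d₁ d₂
    by_contra hne
    have hne' : Φ y₁ ≠ Φ y₂ := fun h => hne (hΦ.1 h₁ h₂ h)
    have hsep := hsepC _ (hΦ.2.1 h₁) _ (hΦ.2.1 h₂) hne'
    have htri : dist (Φ y₁) (Φ y₂) ≤ dist (Φ y₁) (Ψ z) + dist (Ψ z) (Φ y₂) := dist_triangle _ _ _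
    rw [dist_comm (Φ y₁) (Ψ z)] at htri
    linarith
  -- ### window inclusions (one Barlow step ≤ 17/16)
  have hW'W : window S K Ψ (179 / 16) (293 / 16) ⊆ window S K Ψ (81 / 8) (155 / 8) := fun z hz =>
    moatIn_mono₂ (by norm_num) (by norm_num) hz
  have hWA : window S K Ψ (81 / 8) (155 / 8) ⊆ window S K Ψ 8 (43 / 2) := fun z hz =>
    moatIn_mono₂ (by norm_num) (by norm_num) hz
  have hW'1 : ∀ z ∈ window S K Ψ (179 / 16) (293 / 16), ∀ i, linkPt τS z i ∈ window S K Ψ (81 / 8) (155 / 8) :=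
    fun z hz i => moatIn_mono₂ (by norm_num) (by norm_num)
      (mem_window_of_barlowAdj hΨ hgapS hβS' hz (barlowAdj_linkPt τS z i))
  have hW1 : ∀ z ∈ window S K Ψ (81 / 8) (155 / 8), ∀ i, linkPt τS z i ∈ window S K Ψ (145 / 16) (327 / 16) :=
    fun z hz i => moatIn_mono₂ (by norm_num) (by norm_num)
      (mem_window_of_barlowAdj hΨ hgapS hβS' hz (barlowAdj_linkPt τS z i))
  have hW1A : ∀ z ∈ window S K Ψ (81 / 8) (155 / 8), ∀ i, linkPt τS z i ∈ window S K Ψ 8 (43 / 2) :=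
    fun z hz i => moatIn_mono₂ (by norm_num) (by norm_num) (hW1 z hz i)
  have hW2A : ∀ z ∈ window S K Ψ (81 / 8) (155 / 8), ∀ i j,
      linkPt τS (linkPt τS z i) j ∈ window S K Ψ 8 (43 / 2) :=
    fun z hz i j => moatIn_mono₂ (by norm_num) (by norm_num)
      (mem_window_of_barlowAdj hΨ hgapS hβS' (hW1 z hz i) (barlowAdj_linkPt τS _ j))
  -- ### link maps on the mid window (Part ZZ)
  obtain ⟨hmaps, hnb⟩ := isLinkMap_window_of_partners hΨ hΦ hsepS hεS hgapS hβS hsepC hεC hgapC hβC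
    hA hWA hW1A hW2A
  -- ### a base point of the deep window (R2-S at a container atom)
  obtain ⟨k₀, hk₀⟩ := hKne
  obtain ⟨x₁, hx₁⟩ := hsurjΨ k₀ (hKS hk₀)
  obtain ⟨y, hy, -⟩ := hR2S x₁ ⟨k₀, hk₀, by rw [hx₁, dist_self]; norm_num⟩ 0 (by norm_num) (by norm_num)
  -- ### normalisation (Part ZZS, rider R1)
  obtain ⟨σ, σ', τ'', Rs, h1, h2, hiff, hRs, hchart, hpar, hW2, -⟩ :=
    exists_normalised_chart' hΦ hmaps hnb hW'W hW'1 hy (fun x hx => hR1.1 y (hW'W hy) x hx)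
      (fun x hx => hR1.2 y hy x hx)
  -- ### the slab isomorphism (Part ZZR, rider R1)
  obtain ⟨Θ, hΘinj, -, -, hΘW, hΘiso, hΘls⟩ :=
    exists_slabIso (W := window S K Ψ (179 / 16) (293 / 16)) (fun x hx => (hW2 x hx).1)
      (fun x hx => (hW2 x hx).2) hy (fun x hx => hR1.2 y hy x hx)
  -- ### readability of target sheets near the container (rider R2-C + partner uniqueness + ZZS clause 3)
  have readable : ∀ y' ∈ D, (∃ k ∈ K, dist (Φ y') k < 27 / 2) → y'.1 ∈ Rs ∧ y'.1 - 1 ∈ Rs := by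
    intro y' hy'D hk
    have key : ∀ m : ℤ, (m = y'.1 ∨ m = y'.1 - 1) → m ∈ Rs := by
      intro m hm
      obtain ⟨z, hzW, y'', hy''D, hd, hm'⟩ := hR2C y' hy'D hk m hm
      obtain ⟨hgzD, hgz⟩ := hA z (hWA hzW)
      have he : g z = y'' := puniq z (g z) y'' hgzD hy''D hgz hd
      refine hRs m ⟨z, hzW, ?_⟩
      rw [he]
      exact hm'
    exact ⟨key _ (Or.inl rfl), key _ (Or.inr rfl)⟩
  -- ### distance bookkeeping: the atom of `K` attaining `d(p, K)`
  have hKne' : K.Nonempty := ⟨k₀, hk₀⟩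
  have attain : ∀ p : E3, ∃ k ∈ K, Metric.infDist p K = dist p k := fun p =>
    hKfin.isCompact.exists_infDist_eq_dist hKne' p
  -- ### the inputs of the pin extension (Part ZZT) for `g'' = σ ∘ g`, chart `Φ ∘ σ'` on `D''`
  have hA'' : ∀ x, Ψ x ∈ moatIn S K 8 (43 / 2) → Metric.infDist (Ψ x) K ≤ 1067 / 80 →
      (σ ∘ g) x ∈ {y' : ℤ × ℤ × ℤ | σ' y' ∈ D ∧ (σ' y').1 ∈ Rs ∧ (σ' y').1 - 1 ∈ Rs} ∧
        dist (Ψ x) ((Φ ∘ σ') ((σ ∘ g) x)) ≤ ε := by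
    intro x hx hd
    obtain ⟨hgD, hgd⟩ := hA x hx
    obtain ⟨k, hk, he⟩ := attain (Ψ x)
    have hk' : dist (Φ (g x)) k < 27 / 2 := by
      have := dist_triangle (Φ (g x)) (Ψ x) k
      rw [dist_comm (Φ (g x)) (Ψ x)] at this
      linarith
    refine ⟨?_, by rw [hpar x]; exact hgd⟩
    show σ' (σ (g x)) ∈ D ∧ (σ' (σ (g x))).1 ∈ Rs ∧ (σ' (σ (g x))).1 - 1 ∈ Rs
    rw [h1]
    exact ⟨hgD, readable (g x) hgD ⟨k, hk, hk'⟩⟩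
  have hknown : ∀ x, Ψ x ∈ moatIn S K (145 / 16) (43 / 2) → 179 / 16 < Metric.infDist (Ψ x) K →
      Metric.infDist (Ψ x) K ≤ 1067 / 80 → (σ ∘ g) x = Θ x := by
    intro x hx hlo'' hhi''
    have hxW' : x ∈ window S K Ψ (179 / 16) (293 / 16) := by
      refine ⟨hx.1, (Metric.infDist_lt_iff hKne').1 (by linarith), fun k hk => ?_⟩
      exact lt_of_lt_of_le hlo'' (Metric.infDist_le_dist_of_mem hk)
    exact ((hΘW x hxW').1).symm
  have hT : ∀ x, Ψ x ∈ moatIn S K (145 / 16) (43 / 2) → Metric.infDist (Ψ x) K ≤ 179 / 16 →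
      x ∈ hfin.toFinset := by
    intro x hx hd
    obtain ⟨k, hk, he⟩ := attain (Ψ x)
    exact hfin.mem_toFinset.2 ⟨k, hk, by rw [← he]; linarith⟩
  -- layer coverage three links deep (rider R2-S)
  have cover3 : ∀ x : ℤ × ℤ × ℤ, (∃ k ∈ K, dist (Ψ x) k ≤ 179 / 16) → ∀ p : ℤ × ℤ × ℤ,
      x.1 - 3 ≤ p.1 → p.1 ≤ x.1 + 3 →
        p.1 ∈ {k : ℤ | ∃ w ∈ window S K Ψ (179 / 16) (293 / 16), w.1 = k} := by
    intro x hx p hlo'' hhi''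
    obtain ⟨w, hw, hw1⟩ := hR2S x hx (p.1 - x.1) (by omega) (by omega)
    exact ⟨w, hw, by rw [hw1]; omega⟩
  have hN : ∀ x, Ψ x ∈ moatIn S K (145 / 16) (43 / 2) → Metric.infDist (Ψ x) K ≤ 179 / 16 →
      (∀ i, linkPt τS x i ∈ {y : ℤ × ℤ × ℤ | y.1 ∈ {k : ℤ | ∃ w ∈ window S K Ψ (179 / 16) (293 / 16), w.1 = k}}) ∧
      (∀ i j, linkPt τS (linkPt τS x i) j ∈
        {y : ℤ × ℤ × ℤ | y.1 ∈ {k : ℤ | ∃ w ∈ window S K Ψ (179 / 16) (293 / 16), w.1 = k}}) ∧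
      ∀ i j l, linkPt τS (linkPt τS (linkPt τS x i) j) l ∈
        {y : ℤ × ℤ × ℤ | y.1 ∈ {k : ℤ | ∃ w ∈ window S K Ψ (179 / 16) (293 / 16), w.1 = k}} := by
    intro x hx hd
    obtain ⟨k, hk, he⟩ := attain (Ψ x)
    have hxk : ∃ k ∈ K, dist (Ψ x) k ≤ 179 / 16 := ⟨k, hk, by rw [← he]; exact hd⟩
    have b1 := fun i => linkPt_fst_bounds τS x i
    have b2 := fun i j => linkPt_fst_bounds τS (linkPt τS x i) j
    have b3 := fun i j l => linkPt_fst_bounds τS (linkPt τS (linkPt τS x i) j) l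
    refine ⟨fun i => cover3 x hxk _ ?_ ?_, fun i j => cover3 x hxk _ ?_ ?_, fun i j l => cover3 x hxk _ ?_ ?_⟩
    · linarith [(b1 i).1]
    · linarith [(b1 i).2]
    · linarith [(b1 i).1, (b2 i j).1]
    · linarith [(b1 i).2, (b2 i j).2]
    · linarith [(b1 i).1, (b2 i j).1, (b3 i j l).1]
    · linarith [(b1 i).2, (b2 i j).2, (b3 i j l).2]
  -- ### the REGISTRATION-TRANSPORT pin extension (Part ZZZB): `σ ∘ g = Θ` on the pin moat `(145/16, 43/2)`
  -- within `1067/80` of `K` — registration `hA''` on the whole moat `(8, 43/2)` is the ONLY target-side input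
  have hpin := pin_extension_reg_record
    (N := {y : ℤ × ℤ × ℤ | y.1 ∈ {k : ℤ | ∃ w ∈ window S K Ψ (179 / 16) (293 / 16), w.1 = k}})
    hfin.toFinset hΨ hclean hsepS hεS hgapS hβS hβS' hchart hlo' hKfin hKne' hK hA'' hknown hT hN
    (fun y y' hy => hΘiso y y' hy) (fun y _ v hv => hΘls y v hv)
  -- ### the six outputs
  refine ⟨Θ, {k : ℤ | ∃ w ∈ window S K Ψ (179 / 16) (293 / 16), w.1 = k}, Φ ∘ σ', τ'',
    {y' : ℤ × ℤ × ℤ | σ' y' ∈ D ∧ (σ' y').1 ∈ Rs ∧ (σ' y').1 - 1 ∈ Rs}, hchart, ?_, hΘinj, hΘiso, ?_, ?_⟩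
  · -- link closure of `D''` within `21/2` of `K`: ONE-SIDED transport (Part ZZS clause 2) + `hlc` + R2-C
    rintro y ⟨hyD, hyR, hyR'⟩ ⟨k, hk, hdk⟩ y' hadj
    have hadjC : BarlowAdj τC (σ' y) (σ' y') := (hiff (σ' y) (σ' y') hyR hyR').1 (by rwa [h2, h2])
    have hy'D : σ' y' ∈ D := hlc (σ' y) hyD ⟨k, hk, hdk⟩ (σ' y') hadjC
    have hb : IsBond (Φ (σ' y)) (Φ (σ' y')) := (hΦ.2.2 (σ' y) hyD (σ' y') hy'D).2 hadjC
    have hk' : dist (Φ (σ' y')) k < 27 / 2 := by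
      have := dist_triangle (Φ (σ' y')) (Φ (σ' y)) k
      have h' : dist ((Φ ∘ σ') y) k = dist (Φ (σ' y)) k := rfl
      rw [dist_comm (Φ (σ' y')) (Φ (σ' y))] at this
      linarith [hb.2]
    exact ⟨hy'D, readable (σ' y') hy'D ⟨k, hk, hk'⟩⟩
  · -- partners on the pin moat within `13` of `K`
    rintro x hx ⟨k, hk, hdk⟩
    have hd : Metric.infDist (Ψ x) K ≤ 1067 / 80 := (Metric.infDist_le_dist_of_mem hk).trans (by linarith)
    have hxA : Ψ x ∈ moatIn S K 8 (43 / 2) := moatIn_mono₂ (by norm_num) (by norm_num) hx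
    obtain ⟨hD, hdist⟩ := hA'' x hxA hd
    rw [hpin x hx hd] at hD hdist
    exact ⟨hD, hdist⟩
  · -- sites within `179/16` of `K` lie in read sheets (rider R2-S, `j = 0`) — serves every label radius `r_Θ ≤ 179/16`
    rintro x hx
    obtain ⟨w, hw, hw1⟩ := hR2S x hx 0 (by norm_num) (by norm_num)
    exact ⟨w, hw, by rw [hw1]; ring⟩

/-- ★ the degenerate container `K = ∅` for the registration-transport edition (empty moat, `Θ = id`). -/
theorem slabIso_package_reg_of_empty {S C : Set E3} {D : Set (ℤ × ℤ × ℤ)} {Ψ Φ : ℤ × ℤ × ℤ → E3}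
    {τS τC : ℤ → Bool} {ε : ℝ} (hΦ : IsBarlowBondChart C D Φ τC) :
    ∃ (Θ : ℤ × ℤ × ℤ → ℤ × ℤ × ℤ) (Kread : Set ℤ) (Φ'' : ℤ × ℤ × ℤ → E3) (τ'' : ℤ → Bool)
      (D'' : Set (ℤ × ℤ × ℤ)),
      IsBarlowBondChart C D'' Φ'' τ'' ∧
      (∀ y ∈ D'', (∃ k ∈ (∅ : Set E3), dist (Φ'' y) k < 21 / 2) → ∀ y' : ℤ × ℤ × ℤ,
        BarlowAdj τ'' y y' → y' ∈ D'') ∧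
      Function.Injective Θ ∧
      (∀ x x' : ℤ × ℤ × ℤ, x.1 ∈ Kread → (BarlowAdj τS x x' ↔ BarlowAdj τ'' (Θ x) (Θ x'))) ∧
      (∀ y : ℤ × ℤ × ℤ, Ψ y ∈ moatIn S (∅ : Set E3) (145 / 16) (43 / 2) → (∃ k ∈ (∅ : Set E3), dist (Ψ y) k < 13) →
        Θ y ∈ D'' ∧ dist (Ψ y) (Φ'' (Θ y)) ≤ ε) ∧
      (∀ x : ℤ × ℤ × ℤ, (∃ k ∈ (∅ : Set E3), dist (Ψ x) k ≤ 179 / 16) → x.1 ∈ Kread) :=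
  ⟨id, ∅, Φ, τC, D, hΦ, fun _ _ ⟨_, hk, _⟩ => (Set.notMem_empty _ hk).elim, fun _ _ h => h,
    fun _ _ hx => (Set.notMem_empty _ hx).elim, fun _ _ ⟨_, hk, _⟩ => (Set.notMem_empty _ hk).elim,
    fun _ ⟨_, hk, _⟩ => (Set.notMem_empty _ hk).elim⟩

end Summit.AtomisticToContinuum.Crystallization.Theorems.ChartedZeroExcessLayeredLatticeLiouville

end
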